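import Summits.QuantumFields.BalabanUV.T4Continuum.Support.NE7K1LinWalkCommutator
import Summits.QuantumFields.BalabanUV.T4Continuum.Support.NE7K1LinTwoRunFaces

/-!
# NE7K1LinWalkLineCoarse — row NE7 (node U5), candidate route HOM, path H1L, cell K1-lin(s): THE COARSE BLOCK OF RUN B IN CLOSED FORM —
# `(H_B)₁₁ = P_A + (L−1)·lap(n²·[∼])` EXACTLY (the face count as an EQUALITY), hence its cut-off commutator is form-bounded with
# MESH-FREE constants (the `V`-rows of the two-cutoff line's walk expansion)

Lineage `b2b-balaban-t4-ne7-p2` (CRUX PROVER NE7 #2), generation 68; series (RW) file 10, over `NE7K1LinTwoRunFaces` (g65: the face count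
`fineDirichlet_blockConst_le`, «an equality; ≤ is what is consumed») and `NE7K1LinWalkCommutator` (file 4).  For the two-cutoff line's walk
expansion (`NE7K1LinWalkLine.comm_extLine`) the coarse rows of the fine sandwich are `L^{d+1}·s·[diag λ, (H_B)₁₁]a`, so the ENTRIES of
`(H_B)₁₁ = L^{−(d+1)}(TᵀP_fT)₁₁` (the block-constant trial operator) are needed, not only its form bounds (`trial_form_le` L², g65's L):

* `dirPlus_eq`, `dirMinus_eq`, **`fineDirichlet_blockConst_eq`** — the face count AS AN EQUALITY on a union of `L`-blocks:
  `Σ_{x′}Σ_{y′∼x′}(V(blk x′) − V(blk y′))² = L^d·Σ_XΣ_{Y∼X}(V_X − V_Y)²` (a coarse neighbour present in `R` has all its fine points in `R′`).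
* **`trial_form_eq`**: `⟨(V,0), H_B(V,0)⟩ = ⟨V, P_A V⟩ + (L−1)·⟨V, lap(adjC n)V⟩` (`lap(adjC n)` = `n²·(−Δ^N)` on the coarse region).
* `eq_of_isSymm_of_form_eq` (polarisation) ⇒ **`runB_toBlocks₁₁_eq`**: `(H_B)₁₁ = P_A + (L−1)·lap(adjC n)` as MATRICES; `lap_smul`;
  `runB₁₁_eq_lap_add_blocks` (`= lap(L·adjC n) + Σ_b (a∕|b|)1_b⊗1_b`, the shape of file 4).
* **`comm_mulVec_sq_le_runB₁₁`**: for a cut-off with bond ∕ Neumann-second-difference ∕ block oscillations `ℓ₁, ℓ₂, ℓ₃`,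
  `‖[diag λ,(H_B)₁₁]v‖² ≤ 12(d+1)Ln²ℓ₁²·⟨v,(H_B)₁₁v⟩ + 3((Ln²ℓ₂)² + a²ℓ₃²)‖v‖²` — `NE7K1LinWalkCommutator.comm_mulVec_sq_le_lap_add_blocks` with
  coupling `L·n²`; with `ℓ₁ = 4∕(Mn)`, `ℓ₂ = 32(d+1)∕(Mn)²`, `ℓ₃ = 4(d+1)n∕(Mn)` NO power of `n` survives.

HONEST FRAMING: [folklore] finite sums at the Gaussian `A = 0` level; nothing of Bałaban's asserted; no `sorry`.  Census only (a helper for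
the LINE's walk expansion; the ψ-rows and the assembly remain); NO letter ∕ tag ∕ size of NE7 moves; NE7 NOT PRINTED ∕ NOT PROVED; spine 0∕9;
FIXED FINITE T⁴, rung (B)+1; NOT infinite volume, NOT mass gap, NOT Clay.  HONEST DEPENDENCY: continuum YM on T⁴ ⇐ BetaPertH ∧ nine spine
estimates (0/9 proved); BetaPertH ⇐ (D1) ∧ (D4) ∧ CAP+tail; G-an2-4 gates asym, D1 and NE2/3/4.
-/

noncomputable section

open Finset Matrix

namespace Summit.QuantumFields.BalabanUV.T4Continuum.NE7K1LinWalkLineCoarse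

open Literature.MathematicalPhysics.QuantumFieldTheory.Balaban1983to89
open Literature.MathematicalPhysics.QuantumFieldTheory.Balaban1983to89.B4Reflection242
open Literature.MathematicalPhysics.QuantumFieldTheory.Balaban1983to89.B4BoxCov237
open Literature.MathematicalPhysics.QuantumFieldTheory.Balaban1983to89.B4Lower18
open Literature.MathematicalPhysics.QuantumFieldTheory.Balaban1983to89.B4Green244 (finePt)
open Literature.MathematicalPhysics.QuantumFieldTheory.Balaban1983to89.Beta.CombesThomasForm (lap lap_apply lap_form)
open NE7K1LinSchurLineForm NE7K1LinSchurLineCoords NE7K1LinBlockCoords NE7K1LinSchurLineU1 NE7K1LinTwoRunKit NE7K1LinTwoRunUpper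
  NE7K1LinTwoRunFaces NE7K1LinWalkCommutator

variable {d : ℕ}

/-! ### §1 The face count as an equality -/

section Faces

variable {L : ℕ} [NeZero L] {R' : Finset (Fin (d + 1) → ℤ)} (hR'L : IsBlockUnion L R')

include hR'L in
omit [NeZero L] in
/-- on a union of `L`-blocks, a coarse label present in `R` has every fine point of its block in `R′`. [folklore] -/
theorem mem_of_blk_mem_image {z : Fin (d + 1) → ℤ} (hz : blk L z ∈ R'.image (blk L)) : z ∈ R' := by
  obtain ⟨w, hw, hwz⟩ := Finset.mem_image.mp hz
  exact hR'L hw hwz.symm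

include hR'L in
/-- **ONE CHART POINT, DIRECTION `+e_μ`, EXACTLY**: the fine neighbour `LX + j + e_μ` contributes `[j_μ + 1 = L]·A⁺_μ(X)`. [folklore] -/
theorem dirPlus_eq (V : ↥(R'.image (blk L)) → ℝ) (X : ↥(R'.image (blk L))) (j : Fin (d + 1) → Fin L) (μ : Fin (d + 1)) :
    ∑ y' : ↥R', (if y'.1 = (rchart NeZero.one_le hR'L X j).1 + uvec μ then (V X - V (rblk L R' y')) ^ 2 else (0 : ℝ)) =
      if (j μ : ℕ) + 1 = L then ∑ Y : ↥(R'.image (blk L)), (if Y.1 = X.1 + uvec μ then (V X - V Y) ^ 2 else (0 : ℝ))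
      else 0 := by
  classical
  have hL : 1 ≤ L := NeZero.one_le
  have hpt : (rchart NeZero.one_le hR'L X j).1 = finePt L X.1 j := rfl
  by_cases h : (j μ : ℕ) + 1 = L
  · rw [if_pos h]
    have hblk0 : blk L (finePt L X.1 j + uvec μ) = X.1 + uvec μ := blk_finePt_add_uvec_of_eq hL X.1 μ j h
    by_cases hp : finePt L X.1 j + uvec μ ∈ R'
    · have hblk : (rblk L R' ⟨_, hp⟩).1 = X.1 + uvec μ := hblk0
      have h1 : ∀ y' : ↥R', (y'.1 = (rchart NeZero.one_le hR'L X j).1 + uvec μ) ↔ (y' = ⟨_, hp⟩) := fun y' => by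
        rw [hpt, Subtype.ext_iff]
      simp_rw [h1]
      rw [Finset.sum_ite_eq']
      simp only [Finset.mem_univ, if_true]
      have h2 : ∀ Y : ↥(R'.image (blk L)), (Y.1 = X.1 + uvec μ) ↔ (Y = rblk L R' ⟨_, hp⟩) := fun Y => by
        rw [Subtype.ext_iff, hblk]
      simp_rw [h2]
      rw [Finset.sum_ite_eq']
      simp only [Finset.mem_univ, if_true]
    · have h1 : ∀ y' : ↥R', ¬ (y'.1 = (rchart NeZero.one_le hR'L X j).1 + uvec μ) := fun y' h' =>
        hp (by rw [hpt] at h'; rw [← h']; exact y'.2)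
      have h2 : ∀ Y : ↥(R'.image (blk L)), ¬ (Y.1 = X.1 + uvec μ) := fun Y hY =>
        hp (mem_of_blk_mem_image hR'L (by rw [hblk0, ← hY]; exact Y.2))
      simp only [h1, h2, if_false, Finset.sum_const_zero]
  · rw [if_neg h]
    have hlt : (j μ : ℕ) + 1 < L := lt_of_le_of_ne (by have := (j μ).isLt; omega) h
    refine Finset.sum_eq_zero fun y' _ => ?_
    split_ifs with hy
    · have hb : rblk L R' y' = X := by
        apply Subtype.ext
        show blk L y'.1 = X.1
        rw [hy, hpt, blk_finePt_add_uvec_of_lt hL X.1 μ j hlt]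
      rw [hb, sub_self, zero_pow two_ne_zero]
    · rfl

include hR'L in
/-- **ONE CHART POINT, DIRECTION `−e_μ`, EXACTLY**: the fine neighbour `LX + j − e_μ` contributes `[j_μ = 0]·A⁻_μ(X)`. [folklore] -/
theorem dirMinus_eq (V : ↥(R'.image (blk L)) → ℝ) (X : ↥(R'.image (blk L))) (j : Fin (d + 1) → Fin L) (μ : Fin (d + 1)) :
    ∑ y' : ↥R', (if y'.1 = (rchart NeZero.one_le hR'L X j).1 - uvec μ then (V X - V (rblk L R' y')) ^ 2 else (0 : ℝ)) =
      if (j μ : ℕ) = 0 then ∑ Y : ↥(R'.image (blk L)), (if Y.1 = X.1 - uvec μ then (V X - V Y) ^ 2 else (0 : ℝ))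
      else 0 := by
  classical
  have hL : 1 ≤ L := NeZero.one_le
  have hpt : (rchart NeZero.one_le hR'L X j).1 = finePt L X.1 j := rfl
  by_cases h : (j μ : ℕ) = 0
  · rw [if_pos h]
    have hblk0 : blk L (finePt L X.1 j - uvec μ) = X.1 - uvec μ := blk_finePt_sub_uvec_of_zero hL X.1 μ j h
    by_cases hp : finePt L X.1 j - uvec μ ∈ R'
    · have hblk : (rblk L R' ⟨_, hp⟩).1 = X.1 - uvec μ := hblk0
      have h1 : ∀ y' : ↥R', (y'.1 = (rchart NeZero.one_le hR'L X j).1 - uvec μ) ↔ (y' = ⟨_, hp⟩) := fun y' => by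
        rw [hpt, Subtype.ext_iff]
      simp_rw [h1]
      rw [Finset.sum_ite_eq']
      simp only [Finset.mem_univ, if_true]
      have h2 : ∀ Y : ↥(R'.image (blk L)), (Y.1 = X.1 - uvec μ) ↔ (Y = rblk L R' ⟨_, hp⟩) := fun Y => by
        rw [Subtype.ext_iff, hblk]
      simp_rw [h2]
      rw [Finset.sum_ite_eq']
      simp only [Finset.mem_univ, if_true]
    · have h1 : ∀ y' : ↥R', ¬ (y'.1 = (rchart NeZero.one_le hR'L X j).1 - uvec μ) := fun y' h' =>
        hp (by rw [hpt] at h'; rw [← h']; exact y'.2)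
      have h2 : ∀ Y : ↥(R'.image (blk L)), ¬ (Y.1 = X.1 - uvec μ) := fun Y hY =>
        hp (mem_of_blk_mem_image hR'L (by rw [hblk0, ← hY]; exact Y.2))
      simp only [h1, h2, if_false, Finset.sum_const_zero]
  · rw [if_neg h]
    have hpos : 0 < (j μ : ℕ) := Nat.pos_of_ne_zero h
    refine Finset.sum_eq_zero fun y' _ => ?_
    split_ifs with hy
    · have hb : rblk L R' y' = X := by
        apply Subtype.ext
        show blk L y'.1 = X.1
        rw [hy, hpt, blk_finePt_sub_uvec_of_pos hL X.1 μ j hpos]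
      rw [hb, sub_self, zero_pow two_ne_zero]
    · rfl

include hR'L in
/-- **THE FACE COUNT AS AN EQUALITY**: `Σ_{x′}Σ_{y′∼x′}(V(blk x′) − V(blk y′))² = L^d·Σ_XΣ_{Y∼X}(V_X − V_Y)²` on a union of `L`-blocks —
each coarse bond is crossed by exactly `L^d` fine bonds, and in-block bonds contribute nothing. [folklore] -/
theorem fineDirichlet_blockConst_eq (V : ↥(R'.image (blk L)) → ℝ) :
    ∑ x' : ↥R', ∑ y' : ↥R', (if y'.1 ∈ nbrs x'.1 then (V (rblk L R' x') - V (rblk L R' y')) ^ 2 else (0 : ℝ)) =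
      (L : ℝ) ^ d * ∑ x : ↥(R'.image (blk L)), ∑ y : ↥(R'.image (blk L)),
        (if y.1 ∈ nbrs x.1 then (V x - V y) ^ 2 else (0 : ℝ)) := by
  classical
  rw [sum_eq_sum_blocks hR'L]
  simp_rw [rblk_rchart]
  have hpt : ∀ (X : ↥(R'.image (blk L))) (j : Fin (d + 1) → Fin L),
      ∑ y' : ↥R', (if y'.1 ∈ nbrs (rchart NeZero.one_le hR'L X j).1 then (V X - V (rblk L R' y')) ^ 2 else (0 : ℝ)) =
        ∑ μ : Fin (d + 1), ((if (j μ : ℕ) + 1 = L then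
            ∑ Y : ↥(R'.image (blk L)), (if Y.1 = X.1 + uvec μ then (V X - V Y) ^ 2 else (0 : ℝ)) else 0) +
          (if (j μ : ℕ) = 0 then
            ∑ Y : ↥(R'.image (blk L)), (if Y.1 = X.1 - uvec μ then (V X - V Y) ^ 2 else (0 : ℝ)) else 0)) := by
    intro X j
    rw [nbr_sum_eq_sum_dir]
    exact Finset.sum_congr rfl fun μ _ => by rw [dirPlus_eq hR'L V X j μ, dirMinus_eq hR'L V X j μ]
  simp_rw [hpt]
  have hlast : ∀ μ : Fin (d + 1), ∀ A : ℝ,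
      ∑ j : Fin (d + 1) → Fin L, (if (j μ : ℕ) + 1 = L then A else 0) = (L : ℝ) ^ d * A := by
    intro μ A
    have e : ∀ j : Fin (d + 1) → Fin L, ((j μ : ℕ) + 1 = L) ↔ (j μ = ⟨L - 1, by have := NeZero.one_le (n := L); omega⟩) :=
      fun j => by rw [Fin.ext_iff]; constructor <;> intro h' <;> simp only at h' ⊢ <;> omega
    simp_rw [e]
    rw [← Finset.sum_filter, Finset.sum_const, card_offsets_fixed, nsmul_eq_mul]
    push_cast
    ring
  have hzero : ∀ μ : Fin (d + 1), ∀ A : ℝ,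
      ∑ j : Fin (d + 1) → Fin L, (if (j μ : ℕ) = 0 then A else 0) = (L : ℝ) ^ d * A := by
    intro μ A
    have e : ∀ j : Fin (d + 1) → Fin L, ((j μ : ℕ) = 0) ↔ (j μ = ⟨0, by have := NeZero.one_le (n := L); omega⟩) := fun j => by
      rw [Fin.ext_iff]
    simp_rw [e]
    rw [← Finset.sum_filter, Finset.sum_const, card_offsets_fixed, nsmul_eq_mul]
    push_cast
    ring
  rw [Finset.mul_sum]
  refine Finset.sum_congr rfl fun X _ => ?_
  calc ∑ j : Fin (d + 1) → Fin L, ∑ μ : Fin (d + 1), ((if (j μ : ℕ) + 1 = L then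
            ∑ Y : ↥(R'.image (blk L)), (if Y.1 = X.1 + uvec μ then (V X - V Y) ^ 2 else (0 : ℝ)) else 0) +
          (if (j μ : ℕ) = 0 then
            ∑ Y : ↥(R'.image (blk L)), (if Y.1 = X.1 - uvec μ then (V X - V Y) ^ 2 else (0 : ℝ)) else 0))
      = ∑ μ : Fin (d + 1), ∑ j : Fin (d + 1) → Fin L, ((if (j μ : ℕ) + 1 = L then
            ∑ Y : ↥(R'.image (blk L)), (if Y.1 = X.1 + uvec μ then (V X - V Y) ^ 2 else (0 : ℝ)) else 0) +
          (if (j μ : ℕ) = 0 then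
            ∑ Y : ↥(R'.image (blk L)), (if Y.1 = X.1 - uvec μ then (V X - V Y) ^ 2 else (0 : ℝ)) else 0)) :=
        Finset.sum_comm
    _ = ∑ μ : Fin (d + 1), ((L : ℝ) ^ d * ∑ Y : ↥(R'.image (blk L)), (if Y.1 = X.1 + uvec μ then (V X - V Y) ^ 2 else (0 : ℝ)) +
          (L : ℝ) ^ d * ∑ Y : ↥(R'.image (blk L)), (if Y.1 = X.1 - uvec μ then (V X - V Y) ^ 2 else (0 : ℝ))) := by
        refine Finset.sum_congr rfl fun μ _ => ?_
        rw [Finset.sum_add_distrib, hlast, hzero]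
    _ = (L : ℝ) ^ d * ∑ μ : Fin (d + 1), ∑ Y : ↥(R'.image (blk L)),
          ((if Y.1 = X.1 + uvec μ then (V X - V Y) ^ 2 else (0 : ℝ)) + (if Y.1 = X.1 - uvec μ then (V X - V Y) ^ 2 else 0)) := by
        rw [Finset.mul_sum]
        refine Finset.sum_congr rfl fun μ _ => ?_
        rw [Finset.sum_add_distrib, mul_add]
    _ = (L : ℝ) ^ d * ∑ Y : ↥(R'.image (blk L)), (if Y.1 ∈ nbrs X.1 then (V X - V Y) ^ 2 else (0 : ℝ)) := by
        congr 1
        rw [Finset.sum_comm]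
        exact Finset.sum_congr rfl fun Y _ => sum_dir_ite_eq X.1 Y.1 _

end Faces

/-! ### §2 The coarse block of `H_B` in closed form -/

section Coarse

variable {n L : ℕ} [NeZero L] {R' : Finset (Fin (d + 1) → ℤ)}

/-- the coarse Dirichlet form: `⟨V, lap(adjC n R)V⟩ = (n²∕2)·Σ_XΣ_{Y∼X}(V_X − V_Y)²`. [folklore] -/
theorem lap_adjC_form (R : Finset (Fin (d + 1) → ℤ)) (n : ℕ) (V : ↥R → ℝ) :
    V ⬝ᵥ (lap (adjC n R)).mulVec V = (n : ℝ) ^ 2 / 2 * ∑ x : ↥R, ∑ y : ↥R, (if y.1 ∈ nbrs x.1 then (V x - V y) ^ 2 else (0 : ℝ)) := by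
  rw [lap_form _ (adjC_symm n R), Finset.mul_sum, Finset.sum_div]
  refine Finset.sum_congr rfl fun x _ => ?_
  rw [Finset.mul_sum, Finset.sum_div]
  refine Finset.sum_congr rfl fun y _ => ?_
  unfold adjC
  split_ifs <;> ring

/-- **THE BLOCK-CONSTANT TRIAL FORM, EXACTLY**: `⟨(V,0), H_B(V,0)⟩ = ⟨V, P_A V⟩ + (L−1)·⟨V, lap(adjC n)V⟩` — the block-constant lift costs
exactly `L×` run A's Dirichlet form (face count) and the same averaging form (`avgPart_eq`). [folklore] -/
theorem trial_form_eq (hn : 1 ≤ n) (hR' : IsBlockUnion (n * L) R') (a : ℝ) (V : ↥(R'.image (blk L)) → ℝ) :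
    Sum.elim V (0 : ↥(R'.image (blk L)) × NZ d L → ℝ) ⬝ᵥ (runB (isBlockUnion_fine hR') n a).mulVec (Sum.elim V 0) =
      V ⬝ᵥ (runA n L a R').mulVec V + ((L : ℝ) - 1) * (V ⬝ᵥ (lap (adjC n (R'.image (blk L)))).mulVec V) := by
  classical
  have hL : 1 ≤ L := NeZero.one_le
  have hR'L : IsBlockUnion L R' := isBlockUnion_fine hR'
  have hRc : IsBlockUnion n (R'.image (blk L)) := isBlockUnion_coarse hL hR'
  have hnL : 1 ≤ n * L := Nat.one_le_iff_ne_zero.2 (Nat.mul_ne_zero (Nat.one_le_iff_ne_zero.1 hn) (NeZero.ne L))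
  have hL0 : (L : ℝ) ≠ 0 := by exact_mod_cast (NeZero.ne L)
  rw [runB, dot_congr_mulVec, coordT_inl hR'L V, fineOpR_form hnL hR' a 0, runA, fineOpR_form hn hRc a 0, zero_mul, add_zero,
    zero_mul, add_zero, mul_add, lap_adjC_form]
  have havg := avgPart_eq hn a (fun x' => V (rblk L R' x')) V (fun b => by
    have := blockSum_coordT hR'L (Sum.elim V 0) b
    rw [coordT_inl hR'L V] at this
    exact this)
  rw [havg, fineDirichlet_blockConst_eq hR'L V]
  have hLd : (L : ℝ) ^ (d + 1) = (L : ℝ) ^ d * L := pow_succ _ _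
  rw [hLd]
  push_cast
  field_simp
  ring

/-- **POLARISATION**: two symmetric real matrices with the same quadratic form are equal. [folklore] -/
theorem eq_of_isSymm_of_form_eq {ι : Type*} [Fintype ι] [DecidableEq ι] {A B : Matrix ι ι ℝ} (hA : A.IsSymm) (hB : B.IsSymm)
    (h : ∀ v : ι → ℝ, v ⬝ᵥ A.mulVec v = v ⬝ᵥ B.mulVec v) : A = B := by
  have key : ∀ (M : Matrix ι ι ℝ), M.IsSymm → (∀ v, v ⬝ᵥ M.mulVec v = 0) → M = 0 := by
    intro M hM h0
    ext i j
    have hs : M j i = M i j := hM.apply i j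
    have e1 : ∀ k l : ι, (Pi.single k (1 : ℝ) : ι → ℝ) ⬝ᵥ M.mulVec (Pi.single l 1) = M k l := by
      intro k l
      rw [mulVec_single, dotProduct_comm, dotProduct_single]
      simp
    have hi := h0 (Pi.single i 1)
    have hj := h0 (Pi.single j 1)
    have hij := h0 (Pi.single i 1 + Pi.single j 1)
    rw [mulVec_add, add_dotProduct, dotProduct_add, dotProduct_add, e1, e1, e1, e1] at hij
    rw [e1] at hi hj
    rw [Matrix.zero_apply]
    linarith
  have h1 := key (A - B) (by unfold Matrix.IsSymm at *; rw [transpose_sub, hA, hB]) fun v => by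
    rw [sub_mulVec, dotProduct_sub, h v, sub_self]
  exact sub_eq_zero.mp h1

/-- **THE COARSE BLOCK OF `H_B` IN CLOSED FORM**: `(H_B)₁₁ = P_A + (L−1)·lap(adjC n)` as matrices on run A's lattice (`n ≥ 1`, `R′` a union of
`nL`-blocks): entries `−n²L` on coarse bonds, the averaging entries of `P_A`, diagonal `n²L·deg + a∕n^{d+1}`. [folklore] -/
theorem runB_toBlocks₁₁_eq (hn : 1 ≤ n) (hR' : IsBlockUnion (n * L) R') (a : ℝ) :
    (runB (isBlockUnion_fine hR') n a).toBlocks₁₁ = runA n L a R' + ((L : ℝ) - 1) • lap (adjC n (R'.image (blk L))) := by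
  have hR'L : IsBlockUnion L R' := isBlockUnion_fine hR'
  have hsymB : ((runB hR'L n a).toBlocks₁₁).IsSymm := by
    ext b b'
    simp only [transpose_apply, toBlocks₁₁, Matrix.of_apply]
    exact (runB_isSymm hR'L n a).apply (Sum.inl b) (Sum.inl b')
  have hsymL : (lap (adjC n (R'.image (blk L)))).IsSymm := by
    ext b b'
    simp only [transpose_apply, lap_apply, adjC_symm n _ b b']
    by_cases h : b = b'
    · subst h; rfl
    · rw [if_neg h, if_neg (Ne.symm h)]
  have hsymR : (runA n L a R' + ((L : ℝ) - 1) • lap (adjC n (R'.image (blk L)))).IsSymm := by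
    have h1 : (runA n L a R').IsSymm := fineOpR_isSymm n a 0 _
    unfold Matrix.IsSymm at h1 hsymL ⊢
    rw [transpose_add, transpose_smul, h1, hsymL]
  refine eq_of_isSymm_of_form_eq hsymB hsymR fun V => ?_
  have hform : V ⬝ᵥ ((runB hR'L n a).toBlocks₁₁).mulVec V =
      Sum.elim V (0 : ↥(R'.image (blk L)) × NZ d L → ℝ) ⬝ᵥ (runB hR'L n a).mulVec (Sum.elim V 0) := by
    conv_rhs => rw [← fromBlocks_toBlocks (runB hR'L n a)]
    simp only [fromBlocks_mulVec, Sum.elim_comp_inl, Sum.elim_comp_inr, mulVec_zero, add_zero, sumElim_dotProduct_sumElim,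
      zero_dotProduct]
  rw [hform, trial_form_eq hn hR' a V, add_mulVec, dotProduct_add, smul_mulVec, dotProduct_smul, smul_eq_mul]

/-- the weighted Laplacian is linear in the coupling: `lap(t·c) = t·lap c`. [folklore] -/
theorem lap_smul {ι : Type*} [Fintype ι] [DecidableEq ι] (t : ℝ) (c : ι → ι → ℝ) :
    lap (fun j k => t * c j k) = t • lap c := by
  ext j k
  simp only [lap_apply, Matrix.smul_apply, smul_eq_mul, ← Finset.mul_sum]
  split_ifs <;> ring

set_option maxHeartbeats 800000 in
/-- `(H_B)₁₁` has the shape `lap(L·adjC n) + Σ_b (a∕|b|)1_b ⊗ 1_b` of `NE7K1LinWalkCommutator.comm_mulVec_sq_le_lap_add_blocks`. [folklore] -/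
theorem runB₁₁_eq_lap_add_blocks (hn : 1 ≤ n) (hR' : IsBlockUnion (n * L) R') (a : ℝ) (b b' : ↥(R'.image (blk L))) :
    (runB (isBlockUnion_fine hR') n a).toBlocks₁₁ b b' =
      lap (fun x y => (L : ℝ) * adjC n (R'.image (blk L)) x y) b b' +
        ∑ B : ↥((R'.image (blk L)).image (blk n)), a / ((Finset.univ.filter fun i => rblk n (R'.image (blk L)) i = B).card : ℝ) *
          ((if rblk n (R'.image (blk L)) b = B then (1 : ℝ) else 0) * (if rblk n (R'.image (blk L)) b' = B then (1 : ℝ) else 0)) := by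
  have hRc : IsBlockUnion n (R'.image (blk L)) := isBlockUnion_coarse NeZero.one_le hR'
  have h1 : (runB (isBlockUnion_fine hR') n a).toBlocks₁₁ b b' =
      runA n L a R' b b' + ((L : ℝ) - 1) * lap (adjC n (R'.image (blk L))) b b' := by
    rw [runB_toBlocks₁₁_eq hn hR' a, Matrix.add_apply, Matrix.smul_apply, smul_eq_mul]
  have h2 : runA n L a R' b b' = lap (adjC n (R'.image (blk L))) b b' +
      ∑ B : ↥((R'.image (blk L)).image (blk n)), a / ((Finset.univ.filter fun i => rblk n (R'.image (blk L)) i = B).card : ℝ) *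
        ((if rblk n (R'.image (blk L)) b = B then (1 : ℝ) else 0) * (if rblk n (R'.image (blk L)) b' = B then (1 : ℝ) else 0)) :=
    fineOpR_zero_eq hn hRc a b b'
  have h3 : lap (fun x y => (L : ℝ) * adjC n (R'.image (blk L)) x y) b b' = (L : ℝ) * lap (adjC n (R'.image (blk L))) b b' := by
    rw [lap_smul, Matrix.smul_apply, smul_eq_mul]
  rw [h1, h2, h3]
  ring

/-- **(H-comm) FOR THE COARSE BLOCK OF RUN B, MESH-FREE**: for a cut-off `λ` on run A's lattice with `|λ_x − λ_y| ≤ ℓ₁` across bonds,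
`|Σ_{y∼x,y∈R}(λ_x − λ_y)| ≤ ℓ₂` and `|λ_x − λ_y| ≤ ℓ₃` inside `n`-blocks:
`‖[diag λ,(H_B)₁₁]v‖² ≤ 12(d+1)Ln²ℓ₁²·⟨v,(H_B)₁₁v⟩ + 3((Ln²ℓ₂)² + a²ℓ₃²)·‖v‖²` — with `ℓ₁ ~ 1∕(Mn)`, `ℓ₂ ~ 1∕(Mn)²`, `ℓ₃ ~ 1∕M` NO power of `n`
survives: the `V`-rows of the two-cutoff line's walk expansion. [folklore] -/
theorem comm_mulVec_sq_le_runB₁₁ (hn : 1 ≤ n) (hR' : IsBlockUnion (n * L) R') {a : ℝ} (ha : 0 ≤ a) (lam : ↥(R'.image (blk L)) → ℝ)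
    {ℓ₁ ℓ₂ ℓ₃ : ℝ} (hℓ₁ : 0 ≤ ℓ₁) (hℓ₃ : 0 ≤ ℓ₃)
    (hbond : ∀ x y : ↥(R'.image (blk L)), y.1 ∈ nbrs x.1 → |lam x - lam y| ≤ ℓ₁)
    (hlap : ∀ x : ↥(R'.image (blk L)), |∑ y ∈ univ.filter (fun y : ↥(R'.image (blk L)) => y.1 ∈ nbrs x.1), (lam x - lam y)| ≤ ℓ₂)
    (hblock : ∀ x y : ↥(R'.image (blk L)), blk n x.1 = blk n y.1 → |lam x - lam y| ≤ ℓ₃) (v : ↥(R'.image (blk L)) → ℝ) :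
    (diagonal lam * (runB (isBlockUnion_fine hR') n a).toBlocks₁₁ - (runB (isBlockUnion_fine hR') n a).toBlocks₁₁ * diagonal lam) *ᵥ v ⬝ᵥ
        (diagonal lam * (runB (isBlockUnion_fine hR') n a).toBlocks₁₁ - (runB (isBlockUnion_fine hR') n a).toBlocks₁₁ * diagonal lam) *ᵥ v ≤
      12 * ((d : ℝ) + 1) * L * (n : ℝ) ^ 2 * ℓ₁ ^ 2 * (v ⬝ᵥ (runB (isBlockUnion_fine hR') n a).toBlocks₁₁ *ᵥ v) +
        3 * (((L : ℝ) * (n : ℝ) ^ 2 * ℓ₂) ^ 2 + a ^ 2 * ℓ₃ ^ 2) * (v ⬝ᵥ v) := by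
  classical
  have hRc : IsBlockUnion n (R'.image (blk L)) := isBlockUnion_coarse NeZero.one_le hR'
  have hn0 : (0 : ℝ) < n := by exact_mod_cast hn
  have hL0 : (0 : ℝ) < L := by exact_mod_cast (NeZero.one_le : 1 ≤ L)
  have hcard : ∀ B : ↥((R'.image (blk L)).image (blk n)), ((Finset.univ.filter fun i => rblk n (R'.image (blk L)) i = B).card : ℝ) =
      (n : ℝ) ^ (d + 1) := by
    intro B; rw [card_filter_rblk hn hRc B]; push_cast; rfl
  set c : ↥(R'.image (blk L)) → ↥(R'.image (blk L)) → ℝ := fun x y => (L : ℝ) * adjC n (R'.image (blk L)) x y with hc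
  have hcs : ∀ j k, c j k = c k j := fun j k => by simp only [hc, adjC_symm n (R'.image (blk L)) j k]
  have hc0 : ∀ j k, 0 ≤ c j k := fun j k => mul_nonneg hL0.le (adjC_nonneg n (R'.image (blk L)) j k)
  -- (A)
  have hA : ∀ x : ↥(R'.image (blk L)), ∑ y, c x y * (lam x - lam y) ^ 2 ≤ 2 * ((d : ℝ) + 1) * L * (n : ℝ) ^ 2 * ℓ₁ ^ 2 := by
    intro x
    have h1 : ∀ y, c x y * (lam x - lam y) ^ 2 ≤
        (if adjC n (R'.image (blk L)) x y ≠ 0 then (1 : ℝ) else 0) * ((L : ℝ) * (n : ℝ) ^ 2 * ℓ₁ ^ 2) := by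
      intro y
      by_cases hy : y.1 ∈ nbrs x.1
      · have hne : adjC n (R'.image (blk L)) x y ≠ 0 := by simp [adjC, hy, hn0.ne']
        rw [if_pos hne, one_mul]
        simp only [hc, adjC, hy, if_true]
        have := hbond x y hy
        have h2 : (lam x - lam y) ^ 2 ≤ ℓ₁ ^ 2 := by nlinarith [abs_nonneg (lam x - lam y), sq_abs (lam x - lam y)]
        have h3 : 0 ≤ (L : ℝ) * (n : ℝ) ^ 2 := by positivity
        nlinarith
      · simp [hc, adjC, hy]
    refine (Finset.sum_le_sum fun y _ => h1 y).trans ?_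
    rw [← Finset.sum_mul, Finset.sum_boole]
    have := card_filter_adjC_ne_zero_le n (R'.image (blk L)) x
    have h0 : 0 ≤ (L : ℝ) * (n : ℝ) ^ 2 * ℓ₁ ^ 2 := by positivity
    nlinarith
  -- (B)
  have hB : ∀ x : ↥(R'.image (blk L)), |∑ y, c x y * (lam x - lam y)| ≤ (L : ℝ) * (n : ℝ) ^ 2 * ℓ₂ := by
    intro x
    have h1 : ∑ y, c x y * (lam x - lam y) =
        (L : ℝ) * (n : ℝ) ^ 2 * ∑ y ∈ univ.filter (fun y : ↥(R'.image (blk L)) => y.1 ∈ nbrs x.1), (lam x - lam y) := by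
      rw [Finset.mul_sum, Finset.sum_filter]
      refine Finset.sum_congr rfl fun y _ => ?_
      simp only [hc, adjC]; split_ifs <;> ring
    rw [h1, abs_mul, abs_of_nonneg (by positivity : (0 : ℝ) ≤ (L : ℝ) * (n : ℝ) ^ 2)]
    exact mul_le_mul_of_nonneg_left (hlap x) (by positivity)
  have hδ : ∀ x y : ↥(R'.image (blk L)), rblk n (R'.image (blk L)) x = rblk n (R'.image (blk L)) y → |lam x - lam y| ≤ ℓ₃ :=
    fun x y hxy => hblock x y (congrArg Subtype.val hxy)
  have ha' : ∀ y : ↥(R'.image (blk L)), a / ((Finset.univ.filter fun i => rblk n (R'.image (blk L)) i = rblk n (R'.image (blk L)) y).card : ℝ) *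
      ((Finset.univ.filter fun j => rblk n (R'.image (blk L)) j = rblk n (R'.image (blk L)) y).card : ℝ) ≤ a := by
    intro y; rw [hcard, div_mul_cancel₀ a (by positivity)]
  have h := comm_mulVec_sq_le_lap_add_blocks c hcs hc0 (rblk n (R'.image (blk L)))
    (fun B => a / ((Finset.univ.filter fun i => rblk n (R'.image (blk L)) i = B).card : ℝ)) (fun B => div_nonneg ha (Nat.cast_nonneg _))
    ((runB (isBlockUnion_fine hR') n a).toBlocks₁₁) (runB₁₁_eq_lap_add_blocks hn hR' a) lam
    (A := 2 * ((d : ℝ) + 1) * L * (n : ℝ) ^ 2 * ℓ₁ ^ 2) (by positivity) hA hB hℓ₃ hδ ha' v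
  refine h.trans (le_of_eq ?_)
  ring

end Coarse

end Summit.QuantumFields.BalabanUV.T4Continuum.NE7K1LinWalkLineCoarse

end
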